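import Summits.QuantumFields.YangMills.Theorems.FluctuationComparisonRegPrIntLS2BetaFlatTubeDepthOneUniformTorus
import Literature.MathematicalPhysics.QuantumFieldTheory.Balaban1983to89.B10Eq5RegularAction
import HarnessLib

/-!
# THE ONE-STEP (0.4) AVERAGE IS `ℓ²`-BOUNDED ON PLAQUETTES AND ON THE WILSON ACTION, VOLUME-UNIFORMLY — `Σ_{p′} dist1(Ū(∂p′))² ≤ c(d,L)·Σ_q dist1(U(∂q))²` and
# `A(Ū) ≤ N·c(d,L)·A(U)` for small fields, constants in `d, L` (and `N`) only
# (crux `FluctuationComparisonRegPrIntL`, stmt-QuantumFields-20520; registry v11.4 `Cruxes/FluctuationComparisonRegPrIntL/Lines/semiclassical_s2beta.lean` 3732b7df FROZEN, untouched)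

Cell `ym3-torus` (YM ladder rung R3 = continuum `SU(2)` Yang–Mills on the three-torus — a RUNG: NOT d = 4, NOT infinite volume, NOT a mass gap, NOT Clay).
Width seat `ym3-torus-px12` (gen 22); `--kind proof --supports stmt-QuantumFields-20520 --as helper`, count-neutral, DEFINITION-FREE (0 `def`, 0 `instance`,
0 `notation`, 0 `sorry`, default heartbeats).

WHY.  Iterating the one-block-level `ℓ²` closeness (✓`…S2BetaOneStepL2ClosePair`) down a history of depth `m` needs, at every step, the action of the averaged
field in terms of the action of the field: [Balaban1985Averaging] Prop. 1 in its LOCAL form (lit ✓`BlockAveragingPlaquetteBoundLocal.dist1_plaqHol_avgFun_lt_of_near`: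
one coarse plaquette is controlled by the fine plaquettes based in the `3^d` blocks around its corner) is a SUP statement; squared and summed it costs the multiplicity
`d²(2d+1)^d` of those neighbourhoods (✓`…S2BetaDetRepLocalRows.card_filter_tdist_comp_le`), never the volume; (11) of [Balaban1985UV3] (`1 − reTr ≤ ½dist1²`,
`dist1² ≤ 2N(1 − reTr)`, lit ✓`B10Eq5RegularAction` ∕ ✓`B10Eq71TorusLocal`) converts plaquette squares to actions and back.

WHAT (torus `P`, level `j → j+1` in the standing range, `SU(N)`, `ℰ = expMeanLogSU`; `T_{p′} = Σ_{q near p′} dist1(U(∂q))²` over the fine plaquettes whose base block is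
coordinatewise within `1` of the corner of `p′`).
* §1 `near_tdist_le` (near ⟹ coarse torus distance `≤ d`), `card_near_le` (a fine plaquette is near at most `d²(2d+1)^d` coarse plaquettes), ★ `dist1_sq_plaqHol_avgFun_le_local`
  (`dist1(Ū(∂p′))² ≤ (L² + 6((d+2)L)²)²·T_{p′}` when `√T_{p′}` is under the (0.4) guard).
* §2 ★★ `sum_dist1_sq_plaqHol_avgFun_le` — `Σ_{p′} dist1(Ū(∂p′))² ≤ (L² + 6((d+2)L)²)²·d²(2d+1)^d·Σ_q dist1(U(∂q))²`;
  ★★ `wilsonAction4_avg_le` — `A((blockAvg ℰ).avg U) ≤ N·(L² + 6((d+2)L)²)²·d²(2d+1)^d·A(U)` on `SU(N)`, `N = |n|`.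

HONEST: lattice kinematics + Cauchy–Schwarz over landed letters; nothing of Bałaban's analysis; no registered stub is closed; TUBE-REG∘, GAP♯∘, EXW∘, S2β, crux 20520 NOT
proved; rung R3 = SU(2) YM₃ on T³ — NOT d = 4, NOT infinite volume, NOT a mass gap, NOT Clay; the Yang–Mills mass gap is NOT proved.  Sorry-free, axioms standard.

References: T. Bałaban, CMP **98** (1985) 17–51 [Balaban1985Averaging] (Prop. 1 (51) p.26); CMP **102** (1985) 255–275 [Balaban1985UV3] ((11) p.258); CMP **109** (1987)
249–301 [Balaban1987RG1] ((0.4) p.253).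
-/

set_option autoImplicit false

noncomputable section

namespace Summit.QuantumFields.YangMills.Theorems.FluctuationComparisonRegPrIntLS2BetaOneStepL2ActionOfAverage

open Finset
open Literature.MathematicalPhysics.QuantumFieldTheory.Balaban1983to89
open T4Continuum BlockAveraging AveragingRT ExpMeanLog
open B3Taylor310LocalRemainder (tdist_comm tdist_self tdist_triangle)
open BlockAveragingPlaquetteBoundLocal (dist1_plaqHol_avgFun_lt_of_near)
open Summit.QuantumFields.YangMills.Theorems.FluctuationComparisonRegPrIntLS2BetaDetRepLocalRows (card_filter_tdist_comp_le)
open Summit.QuantumFields.YangMills.Theorems.FluctuationComparisonRegPrIntLS2BetaFlatTubeDepthOneUniformTorus (le_mul_sqrt_of_forall card_filter_plaq_src_eq_le)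

open scoped Matrix.Norms.L2Operator

variable {P : Params} {j : ℕ}

/-! ## §1 The neighbourhood of a coarse plaquette and the per-plaquette bound -/

/-- Coordinatewise neighbours (`y_κ ∈ {z_κ, z_κ ± 1}`) are within coarse torus distance `d`. [folklore] -/
theorem near_tdist_le {y z : Site P (j + 1)} (h : ∀ κ, y κ = z κ ∨ y κ = z κ + 1 ∨ y κ = z κ - 1) : Site.tdist y z ≤ P.d := by
  unfold Site.tdist
  have h1 : ∀ κ, min (y κ - z κ).val (z κ - y κ).val ≤ 1 := by
    intro κ
    have hone : (1 : ZMod (P.sitesPerDir (j + 1))).val ≤ 1 := by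
      rw [ZMod.val_one_eq_one_mod]; exact Nat.mod_le 1 _
    rcases h κ with h | h | h
    · rw [h, sub_self, ZMod.val_zero]; exact (min_le_left _ _).trans (Nat.zero_le _)
    · refine (min_le_left _ _).trans ?_
      rw [h, add_sub_cancel_left]; exact hone
    · refine (min_le_right _ _).trans ?_
      rw [h, sub_sub_cancel]; exact hone
  calc ∑ κ : Fin P.d, min (y κ - z κ).val (z κ - y κ).val ≤ ∑ _κ : Fin P.d, 1 := Finset.sum_le_sum fun κ _ => h1 κ
    _ = P.d := by simp

/-- A fine plaquette is «near» at most `d²(2d+1)^d` coarse plaquettes (volume-free). [cite: Balaban1985UV3, p.258] -/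
theorem card_near_le (q : Plaq P j) :
    (univ.filter fun p : Plaq P (j + 1) => ∀ κ, blockOf q.src κ = p.src κ ∨ blockOf q.src κ = p.src κ + 1 ∨ blockOf q.src κ = p.src κ - 1).card ≤
      P.d ^ 2 * (2 * P.d + 1) ^ P.d := by
  classical
  refine le_trans (Finset.card_le_card fun p hp => ?_)
    (card_filter_tdist_comp_le (fun p : Plaq P (j + 1) => p.src) (m := P.d ^ 2) card_filter_plaq_src_eq_le (blockOf q.src) P.d)
  rw [Finset.mem_filter] at hp ⊢
  exact ⟨Finset.mem_univ _, near_tdist_le hp.2⟩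

/-- ★ **ONE COARSE PLAQUETTE IN `ℓ²`**: with `T_{p′} = Σ_{q near p′} dist1(U(∂q))²` and `√T_{p′}` under the (0.4) guard,
`dist1(Ū(∂p′))² ≤ (L² + 6((d+2)L)²)²·T_{p′}` (lit ✓`dist1_plaqHol_avgFun_lt_of_near` at every letter value `a ∈ (√T, guard)`). [cite: Balaban1985Averaging, Prop. 1 (51) p.26] -/
theorem dist1_sq_plaqHol_avgFun_le_local {n : Type*} [Fintype n] [DecidableEq n] [Nonempty n] (hj : j + 1 ≤ P.m + P.K)
    (U : GaugeField P j (Matrix.specialUnitaryGroup n ℂ)) (p : Plaq P (j + 1))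
    (hT : Real.sqrt (∑ q ∈ univ.filter (fun q : Plaq P j => ∀ κ, blockOf q.src κ = p.src κ ∨ blockOf q.src κ = p.src κ + 1 ∨ blockOf q.src κ = p.src κ - 1),
        dist1 (GaugeField.plaqHol U q) ^ 2) < deltaSU n / ((((P.d + 2) * P.L : ℕ) : ℝ) ^ 2 / 4)) :
    dist1 (GaugeField.plaqHol (avgFun (expMeanLogSU (n := n)) U) p) ^ 2 ≤
      ((P.L : ℝ) ^ 2 + 6 * (((P.d + 2) * P.L : ℕ) : ℝ) ^ 2) ^ 2 *
        ∑ q ∈ univ.filter (fun q : Plaq P j => ∀ κ, blockOf q.src κ = p.src κ ∨ blockOf q.src κ = p.src κ + 1 ∨ blockOf q.src κ = p.src κ - 1),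
          dist1 (GaugeField.plaqHol U q) ^ 2 := by
  classical
  set T := ∑ q ∈ univ.filter (fun q : Plaq P j => ∀ κ, blockOf q.src κ = p.src κ ∨ blockOf q.src κ = p.src κ + 1 ∨ blockOf q.src κ = p.src κ - 1),
      dist1 (GaugeField.plaqHol U q) ^ 2 with hTdef
  set C := (P.L : ℝ) ^ 2 + 6 * (((P.d + 2) * P.L : ℕ) : ℝ) ^ 2 with hCdef
  have hC : 0 ≤ C := by positivity
  have hT0 : 0 ≤ T := Finset.sum_nonneg fun _ _ => sq_nonneg _
  have hq4 : 0 < (((P.d + 2) * P.L : ℕ) : ℝ) ^ 2 / 4 := by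
    have : 0 < (((P.d + 2) * P.L : ℕ) : ℝ) := by
      have h := P.L_pos
      exact_mod_cast Nat.mul_pos (by omega) h
    positivity
  have hUa : ∀ a : ℝ, Real.sqrt T < a → ∀ q : Plaq P j,
      (∀ κ, blockOf q.src κ = p.src κ ∨ blockOf q.src κ = p.src κ + 1 ∨ blockOf q.src κ = p.src κ - 1) → dist1 (GaugeField.plaqHol U q) < a := by
    intro a ha q hq
    have h1 : dist1 (GaugeField.plaqHol U q) ^ 2 ≤ T :=
      Finset.single_le_sum (f := fun q' : Plaq P j => dist1 (GaugeField.plaqHol U q') ^ 2) (fun _ _ => sq_nonneg _)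
        (Finset.mem_filter.mpr ⟨Finset.mem_univ _, hq⟩)
    exact ((Real.le_sqrt (GaugeGroup.dist1_nonneg _) hT0).mpr h1).trans_lt ha
  have hmain : ∀ a : ℝ, Real.sqrt T < a → a < deltaSU n / ((((P.d + 2) * P.L : ℕ) : ℝ) ^ 2 / 4) →
      dist1 (GaugeField.plaqHol (avgFun (expMeanLogSU (n := n)) U) p) ≤ C * a := by
    intro a ha hat
    have ha0 : 0 ≤ a := (Real.sqrt_nonneg T).trans ha.le
    have ht : ((((P.d + 2) * P.L : ℕ) : ℝ) ^ 2 / 4) * a < deltaSU n := by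
      rwa [lt_div_iff₀ hq4, mul_comm] at hat
    exact (dist1_plaqHol_avgFun_lt_of_near hj ha0 p (hUa a ha) ht).le
  have hle := le_mul_sqrt_of_forall hC hT hmain
  have hd0 : 0 ≤ dist1 (GaugeField.plaqHol (avgFun (expMeanLogSU (n := n)) U) p) := GaugeGroup.dist1_nonneg _
  calc dist1 (GaugeField.plaqHol (avgFun (expMeanLogSU (n := n)) U) p) ^ 2 ≤ (C * Real.sqrt T) ^ 2 := pow_le_pow_left₀ hd0 hle 2
    _ = C ^ 2 * T := by rw [mul_pow, Real.sq_sqrt hT0]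

/-! ## §2 The sums over the coarse torus -/

/-- ★★ **THE AVERAGED PLAQUETTES IN `ℓ²`**: `Σ_{p′} dist1(Ū(∂p′))² ≤ (L² + 6((d+2)L)²)²·d²(2d+1)^d·Σ_q dist1(U(∂q))²` when every neighbourhood sum is under the guard —
constants in `d, L` only. [cite: Balaban1985Averaging, Prop. 1 (51) p.26; Balaban1985UV3, (12)-(13) p.259] -/
theorem sum_dist1_sq_plaqHol_avgFun_le {n : Type*} [Fintype n] [DecidableEq n] [Nonempty n] (hj : j + 1 ≤ P.m + P.K)
    (U : GaugeField P j (Matrix.specialUnitaryGroup n ℂ))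
    (hT : ∀ p : Plaq P (j + 1), Real.sqrt (∑ q ∈ univ.filter (fun q : Plaq P j => ∀ κ, blockOf q.src κ = p.src κ ∨ blockOf q.src κ = p.src κ + 1 ∨
        blockOf q.src κ = p.src κ - 1), dist1 (GaugeField.plaqHol U q) ^ 2) < deltaSU n / ((((P.d + 2) * P.L : ℕ) : ℝ) ^ 2 / 4)) :
    ∑ p : Plaq P (j + 1), dist1 (GaugeField.plaqHol (avgFun (expMeanLogSU (n := n)) U) p) ^ 2 ≤
      ((P.L : ℝ) ^ 2 + 6 * (((P.d + 2) * P.L : ℕ) : ℝ) ^ 2) ^ 2 * ((P.d ^ 2 * (2 * P.d + 1) ^ P.d : ℕ) : ℝ) *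
        ∑ q : Plaq P j, dist1 (GaugeField.plaqHol U q) ^ 2 := by
  classical
  set C := (P.L : ℝ) ^ 2 + 6 * (((P.d + 2) * P.L : ℕ) : ℝ) ^ 2 with hCdef
  set M : ℕ := P.d ^ 2 * (2 * P.d + 1) ^ P.d with hMdef
  set f : Plaq P j → ℝ := fun q => dist1 (GaugeField.plaqHol U q) ^ 2 with hfdef
  have hf0 : ∀ q, 0 ≤ f q := fun q => sq_nonneg _
  have hbond : ∀ p : Plaq P (j + 1), dist1 (GaugeField.plaqHol (avgFun (expMeanLogSU (n := n)) U) p) ^ 2 ≤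
      C ^ 2 * ∑ q ∈ univ.filter (fun q : Plaq P j => ∀ κ, blockOf q.src κ = p.src κ ∨ blockOf q.src κ = p.src κ + 1 ∨ blockOf q.src κ = p.src κ - 1), f q :=
    fun p => dist1_sq_plaqHol_avgFun_le_local hj U p (hT p)
  have hex : ∑ p : Plaq P (j + 1), ∑ q ∈ univ.filter (fun q : Plaq P j => ∀ κ, blockOf q.src κ = p.src κ ∨ blockOf q.src κ = p.src κ + 1 ∨
        blockOf q.src κ = p.src κ - 1), f q ≤ (M : ℝ) * ∑ q : Plaq P j, f q := by
    calc ∑ p : Plaq P (j + 1), ∑ q ∈ univ.filter (fun q : Plaq P j => ∀ κ, blockOf q.src κ = p.src κ ∨ blockOf q.src κ = p.src κ + 1 ∨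
            blockOf q.src κ = p.src κ - 1), f q
        = ∑ p : Plaq P (j + 1), ∑ q : Plaq P j,
            (if (∀ κ, blockOf q.src κ = p.src κ ∨ blockOf q.src κ = p.src κ + 1 ∨ blockOf q.src κ = p.src κ - 1) then f q else 0) := by
          refine Finset.sum_congr rfl fun p _ => ?_
          rw [Finset.sum_filter]
      _ = ∑ q : Plaq P j, ∑ p : Plaq P (j + 1),
            (if (∀ κ, blockOf q.src κ = p.src κ ∨ blockOf q.src κ = p.src κ + 1 ∨ blockOf q.src κ = p.src κ - 1) then f q else 0) := Finset.sum_comm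
      _ = ∑ q : Plaq P j, ((univ.filter fun p : Plaq P (j + 1) =>
            ∀ κ, blockOf q.src κ = p.src κ ∨ blockOf q.src κ = p.src κ + 1 ∨ blockOf q.src κ = p.src κ - 1).card : ℝ) * f q := by
          refine Finset.sum_congr rfl fun q _ => ?_
          rw [← Finset.sum_filter, Finset.sum_const, nsmul_eq_mul]
      _ ≤ ∑ q : Plaq P j, (M : ℝ) * f q := by
          refine Finset.sum_le_sum fun q _ => mul_le_mul_of_nonneg_right ?_ (hf0 q)
          exact_mod_cast card_near_le q
      _ = (M : ℝ) * ∑ q : Plaq P j, f q := by rw [Finset.mul_sum]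
  calc ∑ p : Plaq P (j + 1), dist1 (GaugeField.plaqHol (avgFun (expMeanLogSU (n := n)) U) p) ^ 2
      ≤ ∑ p : Plaq P (j + 1), C ^ 2 * ∑ q ∈ univ.filter (fun q : Plaq P j => ∀ κ, blockOf q.src κ = p.src κ ∨ blockOf q.src κ = p.src κ + 1 ∨
          blockOf q.src κ = p.src κ - 1), f q := Finset.sum_le_sum fun p _ => hbond p
    _ = C ^ 2 * ∑ p : Plaq P (j + 1), ∑ q ∈ univ.filter (fun q : Plaq P j => ∀ κ, blockOf q.src κ = p.src κ ∨ blockOf q.src κ = p.src κ + 1 ∨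
          blockOf q.src κ = p.src κ - 1), f q := by rw [Finset.mul_sum]
    _ ≤ C ^ 2 * ((M : ℝ) * ∑ q : Plaq P j, f q) := mul_le_mul_of_nonneg_left hex (sq_nonneg _)
    _ = _ := by rw [hMdef]; ring

/-- ★★ **THE AVERAGED ACTION**: on `SU(N)` (`N = |n|`), `A(Ū) ≤ N·(L² + 6((d+2)L)²)²·d²(2d+1)^d·A(U)` when every neighbourhood sum is under the guard ((11) both ways:
`1 − reTr ≤ ½dist1²` coarse, `dist1² ≤ 2N(1 − reTr)` fine). [cite: Balaban1985Averaging, Prop. 1 (51) p.26; Balaban1985UV3, (11) p.258] -/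
theorem wilsonAction4_avg_le {N : ℕ} [NeZero N] (hj : j + 1 ≤ P.m + P.K) (U : GaugeField P j (Matrix.specialUnitaryGroup (Fin N) ℂ))
    (hT : ∀ p : Plaq P (j + 1), Real.sqrt (∑ q ∈ univ.filter (fun q : Plaq P j => ∀ κ, blockOf q.src κ = p.src κ ∨ blockOf q.src κ = p.src κ + 1 ∨
        blockOf q.src κ = p.src κ - 1), dist1 (GaugeField.plaqHol U q) ^ 2) < deltaSU (Fin N) / ((((P.d + 2) * P.L : ℕ) : ℝ) ^ 2 / 4)) :
    wilsonAction4 ((blockAvg (expMeanLogSU (n := Fin N))).avg U) ≤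
      (N : ℝ) * (((P.L : ℝ) ^ 2 + 6 * (((P.d + 2) * P.L : ℕ) : ℝ) ^ 2) ^ 2 * ((P.d ^ 2 * (2 * P.d + 1) ^ P.d : ℕ) : ℝ)) * wilsonAction4 U := by
  classical
  have hN : Nonempty (Fin N) := ⟨⟨0, Nat.pos_of_ne_zero (NeZero.ne N)⟩⟩
  set C' := ((P.L : ℝ) ^ 2 + 6 * (((P.d + 2) * P.L : ℕ) : ℝ) ^ 2) ^ 2 * ((P.d ^ 2 * (2 * P.d + 1) ^ P.d : ℕ) : ℝ) with hC'
  have hC'0 : 0 ≤ C' := by positivity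
  have hsum := sum_dist1_sq_plaqHol_avgFun_le hj U hT
  -- coarse side: `1 − reTr ≤ ½ dist1²`
  have hcoarse : wilsonAction4 ((blockAvg (expMeanLogSU (n := Fin N))).avg U) ≤
      (1 / 2) * ∑ p : Plaq P (j + 1), dist1 (GaugeField.plaqHol (avgFun (expMeanLogSU (n := Fin N)) U) p) ^ 2 := by
    rw [blockAvg_avg]
    unfold wilsonAction4 wilsonAction
    rw [Finset.mul_sum]
    refine Finset.sum_le_sum fun p _ => ?_
    rw [one_mul]
    exact B10Eq5RegularAction.one_sub_reTr_le_specialUnitaryGroup _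
  -- fine side: `dist1² ≤ 2N(1 − reTr)`
  have hfine : ∑ q : Plaq P j, dist1 (GaugeField.plaqHol U q) ^ 2 ≤ 2 * (N : ℝ) * wilsonAction4 U := by
    unfold wilsonAction4 wilsonAction
    rw [Finset.mul_sum]
    refine Finset.sum_le_sum fun q _ => ?_
    have h := B10Eq71TorusLocal.dist1_sq_le_specialUnitaryGroup (GaugeField.plaqHol U q)
    linarith
  calc wilsonAction4 ((blockAvg (expMeanLogSU (n := Fin N))).avg U)
      ≤ (1 / 2) * ∑ p : Plaq P (j + 1), dist1 (GaugeField.plaqHol (avgFun (expMeanLogSU (n := Fin N)) U) p) ^ 2 := hcoarse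
    _ ≤ (1 / 2) * (C' * ∑ q : Plaq P j, dist1 (GaugeField.plaqHol U q) ^ 2) := by
        refine mul_le_mul_of_nonneg_left ?_ (by norm_num)
        simpa only [hC', mul_assoc] using hsum
    _ ≤ (1 / 2) * (C' * (2 * (N : ℝ) * wilsonAction4 U)) :=
        mul_le_mul_of_nonneg_left (mul_le_mul_of_nonneg_left hfine hC'0) (by norm_num)
    _ = (N : ℝ) * C' * wilsonAction4 U := by ring

end Summit.QuantumFields.YangMills.Theorems.FluctuationComparisonRegPrIntLS2BetaOneStepL2ActionOfAverage

end
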